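import Summits.NavierStokesRegularity.NavierStokesRegularity.Theses.SymmetryModuliCount
import Literature.Analysis.FluidPDE.TypeIAncientMildClassical
import Literature.Analysis.FluidPDE.SwirlMaximumPrinciple
import Literature.Analysis.FluidPDE.KNSSAxisymmetricNoSwirlHolds

/-!
# `AxisymEndLiouville` (stmt-NavierStokesRegularity-14061) — line `absorbing-axis-swirl-extinction`

Skeleton of the lead prover (crux protocol, MODE: LINE).  The crux: an element `u` of the Type-I
ancient mild class `𝒜_C` (`IsTypeIAncientMild C u`) annihilated on a backward end `t < θ ≤ 0` by
the rotation field `x ↦ A (x - c)` of a nonzero skew `A` vanishes on that end.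

Line (absorbing axis / swirl extinction), as reshaped by the lead:

1. `stub_axisNormalForm` — rigid-motion + time-shift covariance of `𝒜_C`: WLOG the axis is the
   vertical axis through `0`, the symmetry holds for all `t < 0` in integrated form
   (`IsAxisymmetric (v t)`), and vanishing of the normalised field gives the crux.
2. `stub_swirlWeightProfile` — an explicit `C²` weight `W` on `(0, ∞)`, continuous on `[0, ∞)`,
   `W ≥ 0`, `W' ≥ 0`, `ρ ≤ K W(ρ)`, with `W'' − (ρ/2 + 1/ρ − C) W' + λ W ≤ 0` for some `λ > 0`
   (closed form: `W = 1 + ∫₀ e^{−A}`, `A = ∫₀ log(1 + e^{C − s/2 − 1/s})`).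
3. `stub_swirlComparison` (hardest, the lead's) — the weighted maximum principle: for `v ∈ 𝒜_C`
   axisymmetric on `t < 0`, `|Γ(t,x)| ≤ C K (t/t')^λ W(r/√(−t))` for all `t' < t < 0`, by
   comparison of `±Γ` with the supersolution `Ψ = C K (t/t')^λ W(r/√(−t))` of the swirl operator
   `∂ₜ + v·∇ + (2/r)∂ᵣ − Δ` (KNSS (1.8), `swirl_transport_holds`) on large balls, escape barrier
   `ε e^{β(t−t')}(1+|x|²)` as in the tree's `SwirlMaximumPrinciple`.
4. `stub_swirlEquation` — the swirl equation in the class on every window (classical pressure by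
   `exists_isClassicalNSSolutionOn_Ioo`, axisymmetric by `isAxisymmetricScalar_pressure`).
5. `stub_weakMaxPrincipleLocal` — the tree's `weak_max_principle` with `C²` slices required only
   on the open set `U` (the comparison function is not `C²` across the axis).
6. `stub_cylProfileCalculus` — gradient / Laplacian / smoothness of `y ↦ g (cylRadius y / s)` off
   the axis.
7. `stub_noSwirlLiouville` — swirl-free elements of `𝒜_C` vanish (KNSS 2009 Thm 5.2, proved in
   tree as `knss_axisymmetric_no_swirl_holds`, + the gauge `eq_zero_of_slice_const`).

Glue (`AxisymEndLiouville_of`, sorry-free): 1 ⇒ normalised `v`; 2 + 3 with `t' → −∞`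
(`(t/t')^λ → 0`) ⇒ `Γ ≡ 0`; 7 ⇒ `v ≡ 0`; 1 ⇒ `u ≡ 0` on the end.
-/

noncomputable section

-- the summit and its single problem share the name `NavierStokesRegularity` (D-0017 nested layout)
set_option linter.dupNamespace false

open Set Function Filter Topology MeasureTheory InnerProductSpace Metric
open scoped RealInnerProductSpace Laplacian ContDiff NNReal

namespace Summit.NavierStokesRegularity.NavierStokesRegularity.Theorems

open Literature.Analysis.FluidPDE

/-- `ℝ³`. -/
local notation "E3" => EuclideanSpace ℝ (Fin 3)

/-! ## Stubs -/

/-- STUB 1 (axis normal form + transfer).  For `u ∈ 𝒜_C` annihilated on `t < θ ≤ 0` by the rotation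
field of a nonzero skew `A` about the axis through `c`, there is `v ∈ 𝒜_C`, axisymmetric about the
vertical axis (integrated sense) for ALL `t < 0`, whose vanishing on `t < 0` gives `u ≡ 0` on
`t < θ` (`v(t, y) = L (u (t + θ, L⁻¹ y + c))` for a linear isometry `L` conjugating `A` to `α J`;
rotation/translation/time-shift covariance of `𝒜_C`; infinitesimal ⇒ integrated axisymmetry). -/
theorem stub_axisNormalForm (C : ℝ) (u : ℝ → E3 → E3) (hu : IsTypeIAncientMild C u)
    (c : E3) (A : E3 →L[ℝ] E3) (θ : ℝ) (hskew : ∀ x, ⟪A x, x⟫ = 0) (hA : A ≠ 0) (hθ : θ ≤ 0)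
    (hsym : ∀ t < θ, ∀ x, fderiv ℝ (u t) x (A (x - c)) - A (u t x) = 0) :
    ∃ v : ℝ → E3 → E3, IsTypeIAncientMild C v ∧ (∀ t < 0, IsAxisymmetric (v t)) ∧
      ((∀ t < 0, ∀ y, v t y = 0) → ∀ t < θ, ∀ x, u t x = 0) := by
  sorry

/-- STUB 2 (the absorbing weight profile, explicit for every `C ≥ 0`).  There are `λ > 0`, `K > 0`
and `W : ℝ → ℝ`, continuous on `[0, ∞)`, `C²` on `(0, ∞)`, with `W ≥ 0`, `W' ≥ 0`, `ρ ≤ K W(ρ)` and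
the supersolution inequality `W'' − (ρ/2 + 1/ρ − C) W' + λ W ≤ 0` on `(0, ∞)`. -/
theorem stub_swirlWeightProfile (C : ℝ) (hC : 0 ≤ C) :
    ∃ lam K : ℝ, 0 < lam ∧ 0 < K ∧ ∃ W : ℝ → ℝ, ContinuousOn W (Ici 0) ∧
      ContDiffOn ℝ 2 W (Ioi 0) ∧ (∀ ρ, 0 ≤ ρ → 0 ≤ W ρ) ∧ (∀ ρ, 0 < ρ → ρ ≤ K * W ρ) ∧
      (∀ ρ, 0 < ρ → 0 ≤ deriv W ρ) ∧
      ∀ ρ, 0 < ρ → deriv (deriv W) ρ - (ρ / 2 + 1 / ρ - C) * deriv W ρ + lam * W ρ ≤ 0 := by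
  sorry

/-- STUB 3 (weighted maximum principle for the swirl — the lead's stub).  For `u ∈ 𝒜_C`
axisymmetric on `t < 0` and a weight profile as in STUB 2,
`|Γ(t, x)| ≤ C K (t/t')^λ W(r/√(−t))` for all `t' < t < 0`. -/
theorem stub_swirlComparison (C lam K : ℝ) (W : ℝ → ℝ) (hlam : 0 < lam) (hK : 0 < K)
    (hWc : ContinuousOn W (Ici 0)) (hW2 : ContDiffOn ℝ 2 W (Ioi 0))
    (hW0 : ∀ ρ, 0 ≤ ρ → 0 ≤ W ρ) (hWK : ∀ ρ, 0 < ρ → ρ ≤ K * W ρ)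
    (hW1 : ∀ ρ, 0 < ρ → 0 ≤ deriv W ρ)
    (hWineq : ∀ ρ, 0 < ρ → deriv (deriv W) ρ - (ρ / 2 + 1 / ρ - C) * deriv W ρ + lam * W ρ ≤ 0)
    (u : ℝ → E3 → E3) (hu : IsTypeIAncientMild C u) (haxi : ∀ t < 0, IsAxisymmetric (u t))
    (t' t : ℝ) (ht' : t' < t) (ht : t < 0) (x : E3) :
    |swirl (u t) x| ≤ C * K * (t / t') ^ lam * W (cylRadius x / Real.sqrt (-t)) := by
  sorry

/-- STUB 4 (the swirl equation in the class).  On every window `(t₀, 0)` an axisymmetric element of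
`𝒜_C` is a classical Navier–Stokes solution for some pressure, and its swirl satisfies KNSS (1.8)
`∂ₜΓ + u·∇Γ = ΔΓ − (2/r)∂ᵣΓ` off the axis. -/
theorem stub_swirlEquation (C : ℝ) (u : ℝ → E3 → E3) (hu : IsTypeIAncientMild C u)
    (haxi : ∀ t < 0, IsAxisymmetric (u t)) (t₀ : ℝ) (ht₀ : t₀ < 0) :
    ∃ p : ℝ → E3 → ℝ, IsClassicalNSSolutionOn (Ioo t₀ 0) 1 0 u p ∧
      ∀ t ∈ Ioo t₀ 0, ∀ x, cylRadius x ≠ 0 →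
        timeDerivWithin (Ioo t₀ 0) (fun s => swirl (u s)) t x + convect (u t) (swirl (u t)) x =
          (Δ (swirl (u t))) x - 2 / cylRadius x * partialDeriv (eR x) (swirl (u t)) x := by
  sorry

/-- STUB 5 (weak parabolic maximum principle, `C²` only on `U`).  The tree's `weak_max_principle`
with the slice regularity required only on the open set `U ⊆ K`. -/
theorem stub_weakMaxPrincipleLocal (K U : Set E3) (hK : IsCompact K) (hU : IsOpen U) (hUK : U ⊆ K)
    (T₁ T₂ : ℝ) (w wₜ : ℝ → E3 → ℝ)
    (hc : ContinuousOn (uncurry w) (Icc T₁ T₂ ×ˢ K))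
    (h2 : ∀ t ∈ Ioc T₁ T₂, ContDiffOn ℝ 2 (w t) U)
    (ht : ∀ t ∈ Ioc T₁ T₂, ∀ x ∈ U, HasDerivWithinAt (fun s => w s x) (wₜ t x) (Icc T₁ t) t)
    (hsub : ∀ t ∈ Ioc T₁ T₂, ∀ x ∈ U, fderiv ℝ (w t) x = 0 → (Δ (w t)) x ≤ 0 → wₜ t x ≤ 0)
    (hbot : ∀ x ∈ K, w T₁ x ≤ 0)
    (hlat : ∀ t ∈ Icc T₁ T₂, ∀ x ∈ K \ U, w t x ≤ 0) :
    ∀ t ∈ Icc T₁ T₂, ∀ x ∈ K, w t x ≤ 0 := by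
  sorry

/-- STUB 6 (calculus of cylindrical profiles off the axis).  For `g` of class `C²` on `(0, ∞)` and
`s > 0`, the function `y ↦ g (r(y)/s)` is `C²` near every off-axis point, with gradient
`(g'(ρ)/s) e_r` and Laplacian `(g''(ρ) + g'(ρ)/ρ)/s²`, `ρ = r/s`. -/
theorem stub_cylProfileCalculus (g : ℝ → ℝ) (hg : ContDiffOn ℝ 2 g (Ioi 0)) (s : ℝ) (hs : 0 < s)
    (x : E3) (hx : cylRadius x ≠ 0) :
    ContDiffAt ℝ 2 (fun y => g (cylRadius y / s)) x ∧
      (∀ v, fderiv ℝ (fun y => g (cylRadius y / s)) x v =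
        deriv g (cylRadius x / s) / s * ⟪eR x, v⟫) ∧
      (Δ (fun y => g (cylRadius y / s))) x =
        (deriv (deriv g) (cylRadius x / s) + deriv g (cylRadius x / s) / (cylRadius x / s)) /
          s ^ 2 := by
  sorry

/-- STUB 7 (swirl-free endgame).  A swirl-free axisymmetric element of `𝒜_C` vanishes identically
(time shift into the bounded class, KNSS 2009 Thm 5.2 = `knss_axisymmetric_no_swirl_holds`, then
the gauge kills axial constants, `IsTypeIAncientMild.eq_zero_of_slice_const`). -/
theorem stub_noSwirlLiouville (C : ℝ) (u : ℝ → E3 → E3) (hu : IsTypeIAncientMild C u)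
    (haxi : ∀ t < 0, IsAxisymmetric (u t)) (hsw : ∀ t < 0, HasNoSwirl (u t)) :
    ∀ t < 0, ∀ x, u t x = 0 := by
  sorry

/-! ## Glue -/

/-- For `λ > 0`, `t < 0` and any `a`: `a (t/t')^λ ≤ η` for some `t' < t` far in the past (`(t/t')^λ → 0`). -/
theorem exists_past_rpow_mul_le (a : ℝ) {lam t η : ℝ} (hlam : 0 < lam) (ht : t < 0)
    (hη : 0 < η) : ∃ t' : ℝ, t' < t ∧ a * (t / t') ^ lam ≤ η := by
  -- `T ↦ a * ((-t) * T⁻¹) ^ lam → 0` as `T → ∞`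
  have h1 : Tendsto (fun T : ℝ => T ^ (-lam)) atTop (𝓝 0) := tendsto_rpow_neg_atTop hlam
  have h2 : Tendsto (fun T : ℝ => a * (-t) ^ lam * T ^ (-lam)) atTop (𝓝 0) := by
    simpa using h1.const_mul (a * (-t) ^ lam)
  have h3 : ∀ᶠ T in atTop, a * (-t) ^ lam * T ^ (-lam) ≤ η :=
    (h2.eventually (ge_mem_nhds hη))
  obtain ⟨T, hT⟩ := (h3.and (eventually_gt_atTop (max (-t) 0))).exists
  obtain ⟨hTη, hTgt⟩ := hT
  have hT0 : 0 < T := lt_of_le_of_lt (le_max_right _ _) hTgt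
  have hTt : -t < T := lt_of_le_of_lt (le_max_left _ _) hTgt
  refine ⟨-T, by linarith, ?_⟩
  have e : (t / -T) = (-t) * T⁻¹ := by field_simp
  rw [e, Real.mul_rpow (by linarith) (inv_nonneg.2 hT0.le), Real.inv_rpow hT0.le,
    ← Real.rpow_neg hT0.le, ← mul_assoc]
  exact hTη

/-- **The crux `AxisymEndLiouville` from the stubs.** -/
theorem AxisymEndLiouville_of :
    Summit.NavierStokesRegularity.NavierStokesRegularity.Theses.SymmetryModuliCount.AxisymEndLiouville := by
  intro C u hu c A θ hskew hA hθ hsym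
  obtain ⟨v, hv, hvaxi, hback⟩ := stub_axisNormalForm C u hu c A θ hskew hA hθ hsym
  apply hback
  have hC : 0 ≤ C := hv.nonneg
  obtain ⟨lam, K, hlam, hK, W, hWc, hW2, hW0, hWK, hW1, hWineq⟩ := stub_swirlWeightProfile C hC
  -- the swirl of `v` vanishes: `|Γ(t,y)| ≤ C K (t/t')^λ W(ρ)` for every `t' < t`, and `t' → -∞`
  have hsw : ∀ t < 0, HasNoSwirl (v t) := by
    intro t ht y
    refine abs_nonpos_iff.1 (le_of_forall_pos_le_add fun η hη => ?_)
    obtain ⟨t', ht', hle⟩ := exists_past_rpow_mul_le (C * K * W (cylRadius y / Real.sqrt (-t))) hlam ht hη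
    have key := stub_swirlComparison C lam K W hlam hK hWc hW2 hW0 hWK hW1 hWineq v hv hvaxi
      t' t ht' ht y
    calc |swirl (v t) y| ≤ C * K * (t / t') ^ lam * W (cylRadius y / Real.sqrt (-t)) := key
      _ = C * K * W (cylRadius y / Real.sqrt (-t)) * (t / t') ^ lam := by ring
      _ ≤ η := hle
      _ ≤ 0 + η := by rw [zero_add]
  exact stub_noSwirlLiouville C v hv hvaxi hsw

end Summit.NavierStokesRegularity.NavierStokesRegularity.Theorems

end
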